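import Mathlib.Algebra.MvPolynomial.Derivation
import Literature.Barriers.ValiantsHypothesis.BDGIL24IsotypicUniqueness
import Literature.Barriers.ValiantsHypothesis.BDGIL24HighestWeightProjectionProofs
import Literature.Barriers.ValiantsHypothesis.BDGIL24CommonEigenspaceProjectors
import HarnessLib

/-!
# Weight projectors as polynomials in the Cartan generators `E_{i,i}` ([BDGIL24, §5.1.1,
# Cor. 5.5]) — the operators `E_{i,i}` on metapolynomials (`BergEtAl2024.eulerOp`), weight spaces as
# their common eigenspaces, and Cor. 5.5 in this model — PROVED

[BDGIL24] = M. van den Berg, P. Dutta, F. Gesmundo, C. Ikenmeyer, V. Lysikov, *Algebraic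
metacomplexity and representation theory*, arXiv:2411.03444, §5.1.1 (p.27, PDF p.28, p0028.txt:L1–L27):

> "Fix a maximal torus `T ⊂ G` and let `𝔥 ⊂ 𝔤` be the corresponding Cartan subalgebra. […] the
> isotypic components of `V` with respect to the action of `T` are exactly the weight spaces. The
> action of `T` induces the action of `𝔥` with the same isotypic components […] We can now apply
> Theorem 5.2 to obtain for every weight `µ ∈ 𝔥*` an element `H_µ ∈ U(𝔤)` such that `H_µ.v` is the
> projection of `v ∈ V` onto the weight space of weight `µ`. […] We can specialize this construction
> to the action of `gl_k` on the space of metapolynomials `W := ℂ[ℂ[x₁,…,x_k]_d]_δ`. The standard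
> Cartan subalgebra consists of all diagonal matrices, and we can take `H_i := E_{i,i}`. The weights
> appearing in `W` correspond to `k`-tuples of nonnegative integers summing to `δd` […].
> **Corollary 5.5.** For each weight `µ = (µ₁,…,µ_k)` with `Σ µ_i = δd` there is an element
> `H_µ ∈ U(gl_k)` of length at most `(δd)^k` which acts on `ℂ[ℂ[x₁,…,x_k]_d]_δ` as the projector onto
> the weight space corresponding to `µ`."

## Tree rendering

* **`eulerOp k d i`** (Definition) — the action of `E_{i,i} ∈ gl_k` on metapolynomials
  `MvPolynomial (DegIdx (Fin k) d) ℂ` (Claim 4.2: `gl_k` acts by derivations): the derivation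
  `Σ_ν (−ν_i) · c_ν ∂/∂c_ν` — the metavariable `c_ν` (coefficient of `x^ν`) has torus weight `−ν` in
  the convention of the tree's `coordRep` (`(g·F)(v) = F(g⁻¹ v)`; cf. `monWeight`,
  `weight_neg_eq_monWeight`). The `U(gl_k)`-module structure itself is not typed; `eulerOp` is its
  Cartan part, which is all §5.1.1 uses.
* `eulerOp_monomial` — metamonomials are common eigenvectors: `E_i (c^s) = wt(s)_i · c^s`;
  `coeff_eulerOp`.
* **`mem_weightSpace_coordRep_iff_forall_eulerOp`** — "the isotypic components of the torus are
  exactly the weight spaces … the action of `𝔥` [has] the same isotypic components": `F ∈ V_χ` iff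
  `E_i F = χ_i F` for all `i`.
* `eulerOp_comm` / `commute_eulerOp` (the `E_i` commute: `U(𝔥)` is commutative),
  `isHomogeneous_eulerOp` (format preserved), `eulerOp_mem_weightSpace`;
* `eulerOp_mem_of_stable`, `eulerOp_mem_span_orbit` — `GL_k`-stable spaces of format-`(δ,d,k)`
  metapolynomials (e.g. the span of an orbit) are stable under the `E_i` (torus part of "the action
  of `G` induces the action of `𝔤`");
* `weightBox k d δ`, `card_weightBox_le`, `monWeight_mem_weightBox` — the weights appearing in
  degree `δ` lie in the box `[-δd, 0]^k` of size `(δd + 1)^k` (the paper prints the exact count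
  `binom(δd+k−1, k−1) ≤ (δd)^k`; the right-hand inequality fails for `δd = 1`, `k ≥ 2`, so the safe
  box bound is vendored — scope caveat, disclosed).
* `apply_eq_weightedHomogeneousComponent` — an operator fixing `V_χ` and killing the other weight
  spaces of degree `δ` is the weight-`χ` projector on degree-`δ` metapolynomials;
* **`cor_5_5`** — Cor. 5.5 in this model, obtained exactly as printed by applying Theorem 5.2
  (`thm_5_2_linearFactors`, eq. (17)) to the commuting family `(E_{i,i})_i`: for every weight `χ`
  there is an ordered product of at most `(δd+1)^k` factors `c · (E_i − a)` which acts on every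
  homogeneous metapolynomial of degree `δ` as THE weight-`χ` projector (Mathlib's
  `weightedHomogeneousComponent` for the weight `ν ↦ −ν`, = the projection of Thm. 1.1 (1) by
  `weightedHomogeneousComponent_mem_weightSpace` / `sub_weightedHomogeneousComponent_mem` /
  `weightComponent_unique`); `cor_5_5_weightSpace` restates the conclusion with `weightSpace`.

Honest framing: representation-theoretic bookkeeping; nothing here bears on `VP ≠ VNP`.

## References
* [BergEtAl2024] arXiv:2411.03444, §4 Claim 4.2 (p.13), §5.1.1 and Cor. 5.5 (p.27, PDF p.28).
-/

noncomputable section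

open MvPolynomial
open scoped BigOperators

namespace Literature.Barriers.ValiantsHypothesis

namespace BergEtAl2024

open Literature.Computability.AlgebraicComplexity Literature.NumberTheory.DiophantineGeometry

variable {k d : ℕ}

/-! ### The Cartan generators `E_{i,i}` acting on metapolynomials -/

/-- **The action of `E_{i,i} ∈ gl_k` on metapolynomials** `ℂ[ℂ[x₁,…,x_k]_d]` (Claim 4.2: by
derivations): the derivation determined by `c_ν ↦ −ν_i · c_ν` on the metavariables, i.e.
`E_i = Σ_ν (−ν_i) c_ν ∂/∂c_ν`; the sign is the dual convention of `coordRep` (the metavariable `c_ν`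
has weight `−ν`, `monWeight`). [cite: BergEtAl2024, §5.1.1 ("we can take H_i := E_{i,i}"), p.27 (PDF p.28)] locator: paper:arxiv-2411.03444 p0028.txt:L17–L18 -/
def eulerOp (k d : ℕ) (i : Fin k) :
    Derivation ℂ (MvPolynomial (DegIdx (Fin k) d) ℂ) (MvPolynomial (DegIdx (Fin k) d) ℂ) :=
  MvPolynomial.mkDerivation ℂ fun ν => (-((ν.1 i : ℕ) : ℂ)) • X ν

/-- `E_i c_ν = −ν_i · c_ν`. [cite: BergEtAl2024, §5.1.1, p.27 (PDF p.28)] -/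
theorem eulerOp_X (i : Fin k) (ν : DegIdx (Fin k) d) :
    eulerOp k d i (X ν) = (-((ν.1 i : ℕ) : ℂ)) • X ν :=
  MvPolynomial.mkDerivation_X _ _ _

/-- **Metamonomials are common eigenvectors of the `E_i`**: `E_i (a c^s) = wt(s)_i · (a c^s)` with
`wt(s) = monWeight s` (weight `−Σ_ν s_ν ν`). [cite: BergEtAl2024, §4 (Example 4.7 / Claim 4.2), p.13 (PDF p.14)] -/
theorem eulerOp_monomial (i : Fin k) (s : DegIdx (Fin k) d →₀ ℕ) (a : ℂ) :
    eulerOp k d i (monomial s a) = ((monWeight s i : ℤ) : ℂ) • monomial s a := by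
  classical
  rw [eulerOp, MvPolynomial.mkDerivation_monomial, Finsupp.sum]
  have hterm : ∀ ν ∈ s.support,
      (monomial (s - Finsupp.single ν 1) ((s ν : ℕ) : ℂ)) •
          ((-((ν.1 i : ℕ) : ℂ)) • X ν : MvPolynomial (DegIdx (Fin k) d) ℂ) =
        (-(((s ν : ℕ) : ℂ) * ((ν.1 i : ℕ) : ℂ))) • monomial s (1 : ℂ) := by
    intro ν hν
    have hle : Finsupp.single ν 1 ≤ s :=
      Finsupp.single_le_iff.2 (Nat.one_le_iff_ne_zero.2 (Finsupp.mem_support_iff.1 hν))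
    rw [smul_eq_mul, mul_smul_comm, X, monomial_mul, mul_one, tsub_add_cancel_of_le hle,
      smul_monomial, smul_monomial]
    congr 1
    simp only [smul_eq_mul]
    ring
  rw [Finset.sum_congr rfl hterm, ← Finset.sum_smul, smul_smul,
    show (monomial s a : MvPolynomial (DegIdx (Fin k) d) ℂ) = a • monomial s 1 by
      rw [smul_monomial, smul_eq_mul, mul_one],
    smul_smul, monWeight_apply, mul_comm a]
  congr 1
  push_cast
  rw [← Finset.sum_neg_distrib]

/-- `E_i F = Σ_s wt(s)_i · F_s c^s`. [cite: BergEtAl2024, §5.1.1, p.27 (PDF p.28)] -/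
theorem eulerOp_apply_eq_sum (i : Fin k) (F : MvPolynomial (DegIdx (Fin k) d) ℂ) :
    eulerOp k d i F = ∑ s ∈ F.support, ((monWeight s i : ℤ) : ℂ) • monomial s (coeff s F) := by
  conv_lhs => rw [F.as_sum]
  rw [map_sum]
  exact Finset.sum_congr rfl fun s _ => eulerOp_monomial i s _

/-- Coefficients: `(E_i F)_s = wt(s)_i · F_s`. [cite: BergEtAl2024, §5.1.1, p.27 (PDF p.28)] -/
theorem coeff_eulerOp (i : Fin k) (F : MvPolynomial (DegIdx (Fin k) d) ℂ)
    (s : DegIdx (Fin k) d →₀ ℕ) :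
    coeff s (eulerOp k d i F) = ((monWeight s i : ℤ) : ℂ) * coeff s F := by
  classical
  rw [eulerOp_apply_eq_sum, coeff_sum]
  simp only [coeff_smul, coeff_monomial, smul_eq_mul, mul_ite, mul_zero]
  rw [Finset.sum_ite_eq']
  split_ifs with h
  · rfl
  · rw [notMem_support_iff.1 h, mul_zero]

/-! ### Weight spaces are the common eigenspaces of the `E_i` -/

/-- A weight vector equals its weight part (uniqueness of the weight decomposition).
[cite: BergEtAl2024, Thm. 1.1 (1), p.4 (PDF p.5)] -/
theorem eq_weightPart_of_mem_weightSpace {χ : Weight (Fin k)}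
    {F : MvPolynomial (DegIdx (Fin k) d) ℂ} (hF : F ∈ weightSpace (coordRep (Fin k) ℂ d) χ) :
    F = ∑ s ∈ F.support with monWeight s = χ, monomial s (coeff s F) := by
  refine weightComponent_unique (Δ := F) hF ?_ (weightPart_mem_weightSpace F χ)
    (sub_weightPart_mem F χ)
  rw [sub_self]
  exact Submodule.zero_mem _

/-- **On the weight space `V_χ` the operator `E_i` is the scalar `χ_i`** (weight vectors are common
eigenvectors of the Cartan generators). [cite: BergEtAl2024, §5.1.1, p.27 (PDF p.28)] locator: paper:arxiv-2411.03444 p0028.txt:L4–L6 -/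
theorem eulerOp_apply_of_mem_weightSpace {χ : Weight (Fin k)} (i : Fin k)
    {F : MvPolynomial (DegIdx (Fin k) d) ℂ} (hF : F ∈ weightSpace (coordRep (Fin k) ℂ d) χ) :
    eulerOp k d i F = ((χ i : ℤ) : ℂ) • F := by
  classical
  have hF' := eq_weightPart_of_mem_weightSpace hF
  conv_lhs => rw [hF']
  conv_rhs => rw [hF']
  rw [map_sum, Finset.smul_sum]
  refine Finset.sum_congr rfl fun s hs => ?_
  rw [eulerOp_monomial, (Finset.mem_filter.1 hs).2]

/-- **Common eigenvectors of the `E_i` are weight vectors**: if `E_i F = χ_i F` for all `i` then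
`F ∈ V_χ`. [cite: BergEtAl2024, §5.1.1, p.27 (PDF p.28)] locator: paper:arxiv-2411.03444 p0028.txt:L4–L6 -/
theorem mem_weightSpace_of_forall_eulerOp {χ : Weight (Fin k)}
    {F : MvPolynomial (DegIdx (Fin k) d) ℂ} (hF : ∀ i, eulerOp k d i F = ((χ i : ℤ) : ℂ) • F) :
    F ∈ weightSpace (coordRep (Fin k) ℂ d) χ := by
  classical
  -- every monomial in the support has weight `χ`
  have hsupp : ∀ s ∈ F.support, monWeight s = χ := by
    intro s hs
    funext i
    have h1 := coeff_eulerOp i F s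
    rw [hF i, coeff_smul, smul_eq_mul] at h1
    have hne : coeff s F ≠ 0 := mem_support_iff.1 hs
    have h2 : ((χ i : ℤ) : ℂ) = ((monWeight s i : ℤ) : ℂ) := mul_right_cancel₀ hne h1
    exact_mod_cast h2.symm
  have hF' : F = ∑ s ∈ F.support with monWeight s = χ, monomial s (coeff s F) := by
    rw [Finset.filter_true_of_mem hsupp]
    exact F.as_sum
  rw [hF']
  exact weightPart_mem_weightSpace F χ

/-- **Weight spaces are exactly the common eigenspaces of the Cartan generators** ("the isotypic
components of `V` with respect to the action of `T` are exactly the weight spaces … the action of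
`𝔥` [has] the same isotypic components"). [cite: BergEtAl2024, §5.1.1, p.27 (PDF p.28)] locator: paper:arxiv-2411.03444 p0028.txt:L4–L6 -/
theorem mem_weightSpace_coordRep_iff_forall_eulerOp (χ : Weight (Fin k))
    (F : MvPolynomial (DegIdx (Fin k) d) ℂ) :
    F ∈ weightSpace (coordRep (Fin k) ℂ d) χ ↔ ∀ i, eulerOp k d i F = ((χ i : ℤ) : ℂ) • F :=
  ⟨fun h i => eulerOp_apply_of_mem_weightSpace i h, mem_weightSpace_of_forall_eulerOp⟩

/-! ### The `E_i` commute and preserve the degree -/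

/-- **The Cartan generators commute on metapolynomials** (`U(𝔥)` is commutative: "Since `𝔥` is
abelian, the universal enveloping algebra `U(𝔥) ⊂ U(𝔤)` is commutative").
[cite: BergEtAl2024, §5.1.1, p.27 (PDF p.28)] locator: paper:arxiv-2411.03444 p0028.txt:L7–L9 -/
theorem eulerOp_comm (i j : Fin k) (F : MvPolynomial (DegIdx (Fin k) d) ℂ) :
    eulerOp k d i (eulerOp k d j F) = eulerOp k d j (eulerOp k d i F) := by
  classical
  refine MvPolynomial.ext _ _ fun s => ?_
  rw [coeff_eulerOp, coeff_eulerOp, coeff_eulerOp, coeff_eulerOp]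
  ring

/-- As endomorphisms, the `E_i` pairwise commute. [cite: BergEtAl2024, §5.1.1, p.27 (PDF p.28)] -/
theorem commute_eulerOp (i j : Fin k) :
    Commute (eulerOp k d i : Module.End ℂ (MvPolynomial (DegIdx (Fin k) d) ℂ))
      (eulerOp k d j : Module.End ℂ (MvPolynomial (DegIdx (Fin k) d) ℂ)) :=
  LinearMap.ext fun F => eulerOp_comm i j F

/-- The `E_i` preserve the format: `E_i` maps homogeneous metapolynomials of degree `δ` to
homogeneous metapolynomials of degree `δ` (it acts diagonally on metamonomials).
[cite: BergEtAl2024, §5.1.1 (E_{i,i} acts on W = ℂ[ℂ[x]_d]_δ), p.27 (PDF p.28)] -/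
theorem isHomogeneous_eulerOp (i : Fin k) {δ : ℕ} {F : MvPolynomial (DegIdx (Fin k) d) ℂ}
    (hF : F.IsHomogeneous δ) : (eulerOp k d i F).IsHomogeneous δ := by
  classical
  intro s hs
  have hs' : coeff s F ≠ 0 := by
    intro h
    apply hs
    rw [coeff_eulerOp, h, mul_zero]
  exact hF hs'

/-- The `E_i` preserve every weight space. [cite: BergEtAl2024, §5.1.1, p.27 (PDF p.28)] -/
theorem eulerOp_mem_weightSpace (i : Fin k) {χ : Weight (Fin k)}
    {F : MvPolynomial (DegIdx (Fin k) d) ℂ} (hF : F ∈ weightSpace (coordRep (Fin k) ℂ d) χ) :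
    eulerOp k d i F ∈ weightSpace (coordRep (Fin k) ℂ d) χ := by
  rw [eulerOp_apply_of_mem_weightSpace i hF]
  exact Submodule.smul_mem _ _ hF

/-! ### The weights appearing in degree `δ` -/

/-- **The box of torus weights `[-δd, 0]^k`** — it contains the weight of every metamonomial of
degree `δ` ("The weights appearing in `W` correspond to `k`-tuples of nonnegative integers summing
to `δd`"; the sign is the dual convention of `coordRep`). Plumbing for the length bound of Cor. 5.5.
[cite: BergEtAl2024, §5.1.1, p.27 (PDF p.28)] locator: paper:arxiv-2411.03444 p0028.txt:L18–L22 -/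
def weightBox (k d δ : ℕ) : Finset (Weight (Fin k)) :=
  (Fintype.piFinset fun _ : Fin k => Finset.range (δ * d + 1)).image fun n i => -((n i : ℕ) : ℤ)

/-- **At most `(δd + 1)^k` weights appear in degree `δ`.** (The paper counts the weights exactly,
`binom(δd + k − 1, k − 1)`, and bounds this by `(δd)^k`, which fails for `δd = 1`, `k ≥ 2`; the box
bound is vendored instead.) [cite: BergEtAl2024, §5.1.1, p.27 (PDF p.28)] locator: paper:arxiv-2411.03444 p0028.txt:L18–L22 -/
theorem card_weightBox_le (k d δ : ℕ) : (weightBox k d δ).card ≤ (δ * d + 1) ^ k := by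
  refine Finset.card_image_le.trans (le_of_eq ?_)
  rw [Fintype.card_piFinset, Finset.prod_const, Finset.card_range, Finset.card_univ,
    Fintype.card_fin]

/-- The weight of every metamonomial of a homogeneous metapolynomial of degree `δ` lies in the box
(`occupation_le`). [cite: BergEtAl2024, §5.1.1, p.27 (PDF p.28)] -/
theorem monWeight_mem_weightBox {δ : ℕ} {Δ : MvPolynomial (DegIdx (Fin k) d) ℂ}
    (hΔ : Δ.IsHomogeneous δ) {s : DegIdx (Fin k) d →₀ ℕ} (hs : s ∈ Δ.support) :
    monWeight s ∈ weightBox k d δ := by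
  refine Finset.mem_image.2 ⟨fun i => ∑ μ ∈ s.support, s μ * μ.1 i, ?_, ?_⟩
  · exact Fintype.mem_piFinset.2 fun i =>
      Finset.mem_range.2 (Nat.lt_succ_of_le (occupation_le hΔ hs i))
  · funext i
    rw [monWeight_apply]

/-! ### Corollary 5.5: the weight projector as a polynomial in the `E_i` -/

/-- The weight part of a homogeneous metapolynomial of degree `δ` for a weight outside the box is
zero. [cite: BergEtAl2024, §5.1.1, p.27 (PDF p.28)] -/
theorem weightedHomogeneousComponent_eq_zero_of_not_mem {δ : ℕ} {χ : Weight (Fin k)}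
    {Δ : MvPolynomial (DegIdx (Fin k) d) ℂ} (hΔ : Δ.IsHomogeneous δ) (hχ : χ ∉ weightBox k d δ) :
    weightedHomogeneousComponent (fun ν : DegIdx (Fin k) d => (fun i : Fin k => -((ν.1 i : ℕ) : ℤ))) χ Δ = 0 := by
  refine weightedHomogeneousComponent_eq_zero' χ Δ fun s hs h => hχ ?_
  rw [weight_neg_eq_monWeight] at h
  rw [← h]
  exact monWeight_mem_weightBox hΔ hs

/-- A homogeneous metapolynomial of degree `δ` is the sum of its weight parts over the box.
[cite: BergEtAl2024, §5.1.1, p.27 (PDF p.28)] -/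
theorem sum_weightedHomogeneousComponent_eq {δ : ℕ} {Δ : MvPolynomial (DegIdx (Fin k) d) ℂ}
    (hΔ : Δ.IsHomogeneous δ) :
    ∑ μ ∈ weightBox k d δ, weightedHomogeneousComponent (fun ν : DegIdx (Fin k) d => (fun i : Fin k => -((ν.1 i : ℕ) : ℤ))) μ Δ = Δ := by
  conv_rhs => rw [← sum_weightedHomogeneousComponent (fun ν : DegIdx (Fin k) d => (fun i : Fin k => -((ν.1 i : ℕ) : ℤ))) Δ]
  refine (finsum_eq_sum_of_support_subset _ fun μ hμ => ?_).symm
  by_contra h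
  exact hμ (weightedHomogeneousComponent_eq_zero_of_not_mem hΔ h)

/-- An operator that fixes the weight-`χ` vectors and kills the weight vectors of the other weights in
the box is the weight-`χ` projector on homogeneous metapolynomials of degree `δ`.
[cite: BergEtAl2024, §5.1.1, p.27 (PDF p.28)] -/
theorem apply_eq_weightedHomogeneousComponent {δ : ℕ} (χ : Weight (Fin k))
    (P : Module.End ℂ (MvPolynomial (DegIdx (Fin k) d) ℂ))
    (hid : ∀ x : MvPolynomial (DegIdx (Fin k) d) ℂ,
      (∀ i, eulerOp k d i x = ((χ i : ℤ) : ℂ) • x) → P x = x)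
    (hzero : ∀ μ ∈ weightBox k d δ, μ ≠ χ → ∀ x : MvPolynomial (DegIdx (Fin k) d) ℂ,
      (∀ i, eulerOp k d i x = ((μ i : ℤ) : ℂ) • x) → P x = 0)
    {Δ : MvPolynomial (DegIdx (Fin k) d) ℂ} (hΔ : Δ.IsHomogeneous δ) :
    P Δ = weightedHomogeneousComponent (fun ν : DegIdx (Fin k) d => (fun i : Fin k => -((ν.1 i : ℕ) : ℤ))) χ Δ := by
  have hpart : ∀ μ ∈ weightBox k d δ, P (weightedHomogeneousComponent (fun ν : DegIdx (Fin k) d => (fun i : Fin k => -((ν.1 i : ℕ) : ℤ))) μ Δ) =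
      if μ = χ then weightedHomogeneousComponent (fun ν : DegIdx (Fin k) d => (fun i : Fin k => -((ν.1 i : ℕ) : ℤ))) μ Δ else 0 := by
    intro μ hμ
    have heig := fun i =>
      eulerOp_apply_of_mem_weightSpace i (weightedHomogeneousComponent_mem_weightSpace (d := d) μ Δ)
    split_ifs with h
    · subst h
      exact hid _ heig
    · exact hzero μ hμ h _ heig
  calc P Δ = P (∑ μ ∈ weightBox k d δ, weightedHomogeneousComponent (fun ν : DegIdx (Fin k) d => (fun i : Fin k => -((ν.1 i : ℕ) : ℤ))) μ Δ) := by
        rw [sum_weightedHomogeneousComponent_eq hΔ]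
    _ = ∑ μ ∈ weightBox k d δ, if μ = χ then weightedHomogeneousComponent (fun ν : DegIdx (Fin k) d => (fun i : Fin k => -((ν.1 i : ℕ) : ℤ))) μ Δ else 0 := by
        rw [map_sum]
        exact Finset.sum_congr rfl hpart
    _ = weightedHomogeneousComponent (fun ν : DegIdx (Fin k) d => (fun i : Fin k => -((ν.1 i : ℕ) : ℤ))) χ Δ := by
        rw [Finset.sum_ite_eq']
        split_ifs with h
        · rfl
        · exact (weightedHomogeneousComponent_eq_zero_of_not_mem hΔ h).symm

/-- **Corollary 5.5 (in the `E_{i,i}`-model).** For every weight `χ` and format `(δ, d, k)` there is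
an ordered product `H_χ = ∏ c_j (E_{i_j} − a_j)` of at most `(δd + 1)^k` factors, each affine-linear
in one Cartan generator `E_{i,i}` (Theorem 5.2, eq. (17), applied to the commuting family
`(E_{i,i})_i` whose common eigenspaces are the weight spaces), which acts on every homogeneous
metapolynomial `Δ` of degree `δ` as the projector onto the weight space of weight `χ`:
`H_χ Δ` is the weight-`χ` part of `Δ`. (Paper: `H_µ ∈ U(gl_k)` of length `≤ (δd)^k`; here the
`U(gl_k)`-action is represented by its Cartan part `eulerOp`, and the length bound is the box bound
`(δd+1)^k`, see `card_weightBox_le`.)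
[cite: BergEtAl2024, Cor. 5.5, p.27 (PDF p.28)] locator: paper:arxiv-2411.03444 p0028.txt:L23–L26 -/
theorem cor_5_5 (k d δ : ℕ) (χ : Weight (Fin k)) :
    ∃ L : List (Fin k × ℂ × ℂ), L.length ≤ (δ * d + 1) ^ k ∧
      ∀ Δ : MvPolynomial (DegIdx (Fin k) d) ℂ, Δ.IsHomogeneous δ →
        (L.map fun t => t.2.1 • ((eulerOp k d t.1 : Module.End ℂ (MvPolynomial (DegIdx (Fin k) d) ℂ)) - algebraMap ℂ (Module.End ℂ (MvPolynomial (DegIdx (Fin k) d) ℂ)) t.2.2)).prod Δ = weightedHomogeneousComponent (fun ν : DegIdx (Fin k) d => (fun i : Fin k => -((ν.1 i : ℕ) : ℤ))) χ Δ := by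
  -- the weights of the box, together with `χ`, as complex characters of the `E_i`
  let castW : Weight (Fin k) → (Fin k → ℂ) := fun μ i => ((μ i : ℤ) : ℂ)
  have hcast : Function.Injective castW := by
    intro μ μ' h
    funext i
    exact Int.cast_injective (congr_fun h i)
  have hχΛ : castW χ ∈ (insert χ (weightBox k d δ)).image castW :=
    Finset.mem_image_of_mem _ (Finset.mem_insert_self χ _)
  obtain ⟨L, hlen, hid, hzero⟩ := thm_5_2_linearFactors
    (fun i => (eulerOp k d i : Module.End ℂ (MvPolynomial (DegIdx (Fin k) d) ℂ))) _ hχΛ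
  refine ⟨L, ?_, fun Δ hΔ => ?_⟩
  · -- length ≤ |Λ| − 1 ≤ #(box) ≤ (δd+1)^k
    rw [Finset.card_image_of_injective _ hcast] at hlen
    have h1 := Finset.card_insert_le χ (weightBox k d δ)
    have h2 := card_weightBox_le k d δ
    omega
  · exact apply_eq_weightedHomogeneousComponent χ _ (fun x hx => hid x hx)
      (fun μ hμ hne x hx => hzero (castW μ)
        (Finset.mem_image_of_mem _ (Finset.mem_insert_of_mem hμ))
        (fun h => hne (hcast h)) x hx) hΔ

/-- **`GL_k`-stable spaces of metapolynomials are stable under the Cartan generators** ("The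
action of `G` on `V` induces the action of the corresponding Lie algebra `𝔤`", for the torus part):
if `N` is a `GL_k`-stable subspace and `p ∈ N` is homogeneous of degree `δ`, then `E_i p ∈ N`
(each weight part of `p` lies in `N`, `weightedHomogeneousComponent_mem_of_stable`, and `E_i` is a
scalar on it). [cite: BergEtAl2024, §5.1.1, p.27 (PDF p.28)] locator: paper:arxiv-2411.03444 p0028.txt:L2–L6 -/
theorem eulerOp_mem_of_stable {δ : ℕ} (N : Submodule ℂ (MvPolynomial (DegIdx (Fin k) d) ℂ))
    (hN : ∀ g : GL (Fin k) ℂ, N ≤ N.comap (coordRep (Fin k) ℂ d g))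
    {p : MvPolynomial (DegIdx (Fin k) d) ℂ} (hp : p ∈ N) (hhom : p.IsHomogeneous δ) (i : Fin k) :
    eulerOp k d i p ∈ N := by
  rw [← sum_weightedHomogeneousComponent_eq hhom, map_sum]
  refine Submodule.sum_mem _ fun μ _ => ?_
  rw [eulerOp_apply_of_mem_weightSpace i (weightedHomogeneousComponent_mem_weightSpace μ p)]
  exact Submodule.smul_mem _ _ (weightedHomogeneousComponent_mem_of_stable N hN hp hhom μ)

/-- In particular the span of the `GL_k`-orbit of a homogeneous metapolynomial `Δ` of degree `δ` is
stable under every `E_i`, so `E_i Δ ∈ span(GL_k · Δ)` — the Cartan part of "`U(gl_k)·Δ ⊆ ⟨GL_k·Δ⟩`".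
[cite: BergEtAl2024, §5.1.1, p.27 (PDF p.28)] -/
theorem eulerOp_mem_span_orbit {δ : ℕ} {Δ : MvPolynomial (DegIdx (Fin k) d) ℂ}
    (hΔ : Δ.IsHomogeneous δ) (i : Fin k) :
    eulerOp k d i Δ ∈ Submodule.span ℂ (Set.range fun h : GL (Fin k) ℂ => coordRep (Fin k) ℂ d h Δ) :=
  eulerOp_mem_of_stable _ (span_orbit_le_comap Δ) (self_mem_span_orbit Δ) hΔ i

/-- **Corollary 5.5, weight-space form**: the operator `H_χ` of `cor_5_5` maps every homogeneous
metapolynomial `Δ` of degree `δ` to THE weight-`χ` component of `Δ` — `H_χ Δ ∈ V_χ` and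
`Δ − H_χ Δ ∈ ⨆_{χ' ≠ χ} V_{χ'}` (the characterisation of Thm. 1.1 (1); unique by
`weightComponent_unique`). [cite: BergEtAl2024, Cor. 5.5, p.27 (PDF p.28)] locator: paper:arxiv-2411.03444 p0028.txt:L23–L26 -/
theorem cor_5_5_weightSpace (k d δ : ℕ) (χ : Weight (Fin k)) :
    ∃ L : List (Fin k × ℂ × ℂ), L.length ≤ (δ * d + 1) ^ k ∧
      ∀ Δ : MvPolynomial (DegIdx (Fin k) d) ℂ, Δ.IsHomogeneous δ →
        (L.map fun t => t.2.1 • ((eulerOp k d t.1 : Module.End ℂ (MvPolynomial (DegIdx (Fin k) d) ℂ)) - algebraMap ℂ (Module.End ℂ (MvPolynomial (DegIdx (Fin k) d) ℂ)) t.2.2)).prod Δ ∈ weightSpace (coordRep (Fin k) ℂ d) χ ∧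
          Δ - (L.map fun t => t.2.1 • ((eulerOp k d t.1 : Module.End ℂ (MvPolynomial (DegIdx (Fin k) d) ℂ)) - algebraMap ℂ (Module.End ℂ (MvPolynomial (DegIdx (Fin k) d) ℂ)) t.2.2)).prod Δ ∈
            ⨆ χ' ∈ {χ' : Weight (Fin k) | χ' ≠ χ}, weightSpace (coordRep (Fin k) ℂ d) χ' := by
  obtain ⟨L, hlen, hL⟩ := cor_5_5 k d δ χ
  refine ⟨L, hlen, fun Δ hΔ => ?_⟩
  rw [hL Δ hΔ]
  exact ⟨weightedHomogeneousComponent_mem_weightSpace χ Δ, sub_weightedHomogeneousComponent_mem χ Δ⟩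

end BergEtAl2024

end Literature.Barriers.ValiantsHypothesis
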